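import Summits.PneNP.PneNP.Theorems.ConvexRankGatesConvexGateBlindXorDefs

/-!
# Characters of `𝔽₂^m`, the flip involution, and sums of `1`-juntas

Support file for crux `ConvexGateBlind` (stmt-PneNP-10680), line `xor-door-perfect-completeness`, open stub
`stub_exactLifting` (lead c2, 2026-08-16). Elementary Fourier-side tools used to CONSTRUCT perfect-completeness
pseudo-expectations (`HasPerfectPseudoExp`) for explicit XOR systems by hand (sibling file `…ExactLiftingK4.lean`):

* §1 `chi_flip`, `sum_mul_eq_zero_of_flip`, `junta_flip`, `sum_chi_mul_junta_eq_zero` — the `±1` character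
  `χ_T(y) = (−1)^{Σ_{l∈T} y_l}` is odd under the flip `y ↦ y + e_i` (`i ∈ T`), a junta on `S ∌ i` is even, so
  `Σ_y χ_T · g = 0` for every junta `g` on a set `S ⊉ T` (orthogonality of characters to low juntas);
* §2 `sum_symmDiff_zmod_two`, `chi_mul_chi`, `sum_chi_eq_zero`, `sum_chi_mul_chi_eq_zero`, `sum_chi_mul_self` —
  `χ_T χ_{T'} = χ_{T Δ T'}` and the orthogonality relations `Σ_y χ_T χ_{T'} = 2^m [T = T']`;
* §3 `exists_decomp_of_mem_span_oneJunta`, `sum_chi_mul_sq_eq_zero` — every element of the span of the `1`-juntas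
  is a sum `Σ_i g_i` of juntas on singletons, and the square of such a sum is orthogonal to every character of a
  set with `≥ 3` elements (the SOS clause of `HasPerfectPseudoExp 3` for any functional whose density is a
  combination of `1` and characters of `3`-sets).
-/

set_option linter.dupNamespace false -- `Summit.PneNP.PneNP.…`: summit = sub-problem (D-0017)

namespace Summit.PneNP.PneNP.Theorems.XorDoor

open scoped BigOperators Classical
open Finset

noncomputable section

/-! ## §1 Characters and the flip involution (general `m`) -/

/-- Flipping coordinate `i` adds `1` to a parity over any `T ∋ i`. -/
theorem sum_add_single_of_mem {m : ℕ} (T : Finset (Fin m)) {i : Fin m} (hi : i ∈ T) (y : Fin m → ZMod 2) :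
    ∑ l ∈ T, (y + Pi.single i (1 : ZMod 2) : Fin m → ZMod 2) l = (∑ l ∈ T, y l) + 1 := by
  simp only [Pi.add_apply, Finset.sum_add_distrib]
  congr 1
  rw [Finset.sum_pi_single']
  simp [hi]

/-- Flipping coordinate `i` does not change a parity over `T ∌ i`. -/
theorem sum_add_single_of_not_mem {m : ℕ} (T : Finset (Fin m)) {i : Fin m} (hi : i ∉ T) (y : Fin m → ZMod 2) :
    ∑ l ∈ T, (y + Pi.single i (1 : ZMod 2) : Fin m → ZMod 2) l = ∑ l ∈ T, y l := by
  refine Finset.sum_congr rfl fun l hl => ?_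
  have : l ≠ i := fun h => hi (h ▸ hl)
  simp [this]

/-- The character `χ_T(y) = ±1` of `T` flips sign under flipping a coordinate `i ∈ T`. -/
theorem chi_flip {m : ℕ} (T : Finset (Fin m)) {i : Fin m} (hi : i ∈ T) (y : Fin m → ZMod 2) :
    (if ∑ l ∈ T, (y + Pi.single i (1 : ZMod 2) : Fin m → ZMod 2) l = 0 then (1 : ℝ) else -1) =
      -(if ∑ l ∈ T, y l = 0 then (1 : ℝ) else -1) := by
  rw [sum_add_single_of_mem T hi]
  have hs : (∑ l ∈ T, y l = 0) ∨ (∑ l ∈ T, y l = 1) := by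
    generalize ∑ l ∈ T, y l = s
    fin_cases s
    · exact Or.inl rfl
    · exact Or.inr rfl
  have h11 : (1 : ZMod 2) + 1 = 0 := by decide
  have h10 : (0 : ZMod 2) + 1 ≠ 0 := by decide
  have h1 : (1 : ZMod 2) ≠ 0 := by decide
  rcases hs with h | h
  · rw [h, if_neg h10, if_pos rfl]
  · rw [h, if_pos h11, if_neg h1, neg_neg]

/-- **Flip involution.** If `φ` is odd and `g` even under `y ↦ y + e_i`, then `Σ_y φ(y) g(y) = 0`. -/
theorem sum_mul_eq_zero_of_flip {m : ℕ} (i : Fin m) (φ g : (Fin m → ZMod 2) → ℝ)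
    (hφ : ∀ y, φ (y + Pi.single i 1) = -φ y) (hg : ∀ y, g (y + Pi.single i 1) = g y) :
    ∑ y, φ y * g y = 0 := by
  have h := Equiv.sum_comp (Equiv.addRight (Pi.single i (1 : ZMod 2))) (fun y => φ y * g y)
  simp only [Equiv.coe_addRight, hφ, hg, neg_mul, Finset.sum_neg_distrib] at h
  linarith

/-- A junta on `S` is even under flipping any `i ∉ S`. -/
theorem junta_flip {m : ℕ} {S : Finset (Fin m)} {g : (Fin m → ZMod 2) → ℝ}
    (hg : ∀ y y' : Fin m → ZMod 2, (∀ l ∈ S, y l = y' l) → g y = g y') {i : Fin m} (hi : i ∉ S)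
    (y : Fin m → ZMod 2) : g (y + Pi.single i 1) = g y :=
  hg _ _ fun l hl => by
    have : l ≠ i := fun h => hi (h ▸ hl)
    simp [this]

/-- **Orthogonality to juntas.** If `T ⊄ S`, the character of `T` is orthogonal to every junta on `S`. -/
theorem sum_chi_mul_junta_eq_zero {m : ℕ} (T S : Finset (Fin m)) (hTS : ¬ T ⊆ S)
    (g : (Fin m → ZMod 2) → ℝ) (hg : ∀ y y' : Fin m → ZMod 2, (∀ l ∈ S, y l = y' l) → g y = g y') :
    ∑ y, (if ∑ l ∈ T, y l = 0 then (1 : ℝ) else -1) * g y = 0 := by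
  obtain ⟨i, hiT, hiS⟩ := Finset.not_subset.1 hTS
  exact sum_mul_eq_zero_of_flip i _ g (chi_flip T hiT) (junta_flip hg hiS)

/-! ## §2 Products of characters -/

/-- Parities add over the symmetric difference (characteristic two). -/
theorem sum_symmDiff_zmod_two {m : ℕ} (T T' : Finset (Fin m)) (y : Fin m → ZMod 2) :
    ∑ l ∈ symmDiff T T', y l = (∑ l ∈ T, y l) + ∑ l ∈ T', y l := by
  have two : (2 : ZMod 2) = 0 := by decide
  rw [symmDiff_def, Finset.sup_eq_union, Finset.sum_union disjoint_sdiff_sdiff,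
    ← Finset.sum_inter_add_sum_sdiff T T' y, ← Finset.sum_inter_add_sum_sdiff T' T y, Finset.inter_comm T' T]
  linear_combination (-(∑ l ∈ T ∩ T', y l)) * two

/-- The product of two `±1` characters is the character of the symmetric difference. -/
theorem chi_mul_chi {m : ℕ} (T T' : Finset (Fin m)) (y : Fin m → ZMod 2) :
    (if ∑ l ∈ T, y l = 0 then (1 : ℝ) else -1) * (if ∑ l ∈ T', y l = 0 then (1 : ℝ) else -1) =
      (if ∑ l ∈ symmDiff T T', y l = 0 then (1 : ℝ) else -1) := by
  rw [sum_symmDiff_zmod_two]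
  have hz : ∀ a : ZMod 2, a = 0 ∨ a = 1 := by decide
  have h11 : (1 : ZMod 2) + 1 = 0 := by decide
  rcases hz (∑ l ∈ T, y l) with ha | ha <;> rcases hz (∑ l ∈ T', y l) with hb | hb <;>
    simp only [ha, hb, add_zero, zero_add, h11, if_true, if_false, one_ne_zero] <;> norm_num

/-- A character sums to zero over the cube unless its support is empty. -/
theorem sum_chi_eq_zero {m : ℕ} (T : Finset (Fin m)) (hT : T.Nonempty) :
    ∑ y : Fin m → ZMod 2, (if ∑ l ∈ T, y l = 0 then (1 : ℝ) else -1) = 0 := by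
  have h := sum_chi_mul_junta_eq_zero T ∅ (by simpa [Finset.subset_empty] using hT.ne_empty) (fun _ => 1)
    (fun _ _ _ => rfl)
  simpa using h

/-- Orthogonality of characters: `Σ_y χ_T χ_T' = 0` for `T ≠ T'`. -/
theorem sum_chi_mul_chi_eq_zero {m : ℕ} (T T' : Finset (Fin m)) (hTT' : T ≠ T') :
    ∑ y : Fin m → ZMod 2,
      (if ∑ l ∈ T, y l = 0 then (1 : ℝ) else -1) * (if ∑ l ∈ T', y l = 0 then (1 : ℝ) else -1) = 0 := by
  simp_rw [chi_mul_chi]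
  exact sum_chi_eq_zero _ (Finset.nonempty_iff_ne_empty.2 (fun h => hTT' (symmDiff_eq_bot.1 h)))

/-- `Σ_y χ_T² = 2^m`. -/
theorem sum_chi_mul_self {m : ℕ} (T : Finset (Fin m)) :
    ∑ y : Fin m → ZMod 2,
      (if ∑ l ∈ T, y l = 0 then (1 : ℝ) else -1) * (if ∑ l ∈ T, y l = 0 then (1 : ℝ) else -1) = 2 ^ m := by
  have h : ∀ y : Fin m → ZMod 2,
      (if ∑ l ∈ T, y l = 0 then (1 : ℝ) else -1) * (if ∑ l ∈ T, y l = 0 then (1 : ℝ) else -1) = 1 := by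
    intro y; split_ifs <;> norm_num
  simp_rw [h]
  rw [Finset.sum_const, Finset.card_univ, Fintype.card_fun, ZMod.card, Fintype.card_fin, nsmul_eq_mul, mul_one]
  push_cast
  rfl

/-! ## §3 Sums of `1`-juntas, and their squares -/

/-- Every element of the span of the `1`-juntas is a sum `Σ_i g_i` with `g_i` a junta on `{i}`. -/
theorem exists_decomp_of_mem_span_oneJunta {m : ℕ} [NeZero m] {s : (Fin m → ZMod 2) → ℝ}
    (hs : s ∈ Submodule.span ℝ {f : (Fin m → ZMod 2) → ℝ | IsJunta 1 f}) :
    ∃ g : Fin m → (Fin m → ZMod 2) → ℝ,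
      (∀ i (y y' : Fin m → ZMod 2), y i = y' i → g i y = g i y') ∧ s = ∑ i, g i := by
  induction hs using Submodule.span_induction with
  | mem x hx =>
    obtain ⟨S, hS, hxS⟩ := hx
    obtain ⟨j, hj⟩ := Finset.card_le_one_iff_subset_singleton.1 hS
    refine ⟨fun i => if i = j then x else 0, fun i y y' hyy => ?_, ?_⟩
    · by_cases hij : i = j
      · subst hij
        show (if i = i then x else 0) y = (if i = i then x else 0) y'
        rw [if_pos rfl]
        exact hxS y y' fun l hl => by
          have : l = i := Finset.mem_singleton.1 (hj hl)
          rw [this]; exact hyy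
      · show (if i = j then x else 0) y = (if i = j then x else 0) y'
        rw [if_neg hij]
        rfl
    · rw [Finset.sum_ite_eq' Finset.univ j (fun _ => x), if_pos (Finset.mem_univ _)]
  | zero => exact ⟨fun _ => 0, fun _ _ _ _ => rfl, by simp⟩
  | add x x' _ _ ihx ihx' =>
    obtain ⟨g, hg, rfl⟩ := ihx
    obtain ⟨g', hg', rfl⟩ := ihx'
    refine ⟨fun i => g i + g' i, fun i y y' hyy => ?_, by rw [Finset.sum_add_distrib]⟩
    simp only [Pi.add_apply, hg i y y' hyy, hg' i y y' hyy]
  | smul a x _ ihx =>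
    obtain ⟨g, hg, rfl⟩ := ihx
    refine ⟨fun i => a • g i, fun i y y' hyy => ?_, by rw [Finset.smul_sum]⟩
    simp only [Pi.smul_apply, hg i y y' hyy]

/-- A character of a set with at least three elements is orthogonal to every product `g_i · g_{i'}` of two
`1`-juntas, hence to the square of any sum of `1`-juntas. -/
theorem sum_chi_mul_sq_eq_zero : ∀ {m : ℕ} (T : Finset (Fin m)), 3 ≤ T.card → ∀ (g : Fin m → (Fin m → ZMod 2) → ℝ), (∀ i (y y' : Fin m → ZMod 2), y i = y' i → g i y = g i y') → ∑ y : Fin m → ZMod 2, (if ∑ l ∈ T, y l = 0 then (1 : ℝ) else -1) * ((∑ i, g i y) * (∑ i, g i y)) = 0 := by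
  intro m T hT g hg
  have hprod : ∀ i i', ∑ y : Fin m → ZMod 2,
      (if ∑ l ∈ T, y l = 0 then (1 : ℝ) else -1) * (g i y * g i' y) = 0 := by
    intro i i'
    refine sum_chi_mul_junta_eq_zero T {i, i'} (fun hsub => ?_) (fun y => g i y * g i' y) fun y y' hyy => ?_
    · have := (Finset.card_le_card hsub).trans (Finset.card_le_two (a := i) (b := i'))
      omega
    · rw [hg i y y' (hyy i (by simp)), hg i' y y' (hyy i' (by simp))]
  calc ∑ y : Fin m → ZMod 2, (if ∑ l ∈ T, y l = 0 then (1 : ℝ) else -1) * ((∑ i, g i y) * (∑ i, g i y))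
      = ∑ y : Fin m → ZMod 2, ∑ i, ∑ i',
          (if ∑ l ∈ T, y l = 0 then (1 : ℝ) else -1) * (g i y * g i' y) := by
        refine Finset.sum_congr rfl fun y _ => ?_
        rw [Finset.sum_mul_sum, Finset.mul_sum]
        refine Finset.sum_congr rfl fun i _ => ?_
        rw [Finset.mul_sum]
    _ = ∑ i, ∑ i', ∑ y : Fin m → ZMod 2,
          (if ∑ l ∈ T, y l = 0 then (1 : ℝ) else -1) * (g i y * g i' y) := by
        rw [Finset.sum_comm]
        refine Finset.sum_congr rfl fun i _ => ?_
        rw [Finset.sum_comm]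
    _ = 0 := Finset.sum_eq_zero fun i _ => Finset.sum_eq_zero fun i' _ => hprod i i'


end

end Summit.PneNP.PneNP.Theorems.XorDoor
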